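import Mathlib
import Summits.CriticalPhenomena.PercolationContinuityZ3.Theorems.PercNearOneGluingAdditiveGluingPocketBHKCov
import Summits.CriticalPhenomena.PercolationContinuityZ3.Theorems.PercNearOneGluingAdditiveGluingGoodStepBridge
import HarnessLib

/-! # Crux `PercNearOneGluing.AdditiveGluing` (stmt-CriticalPhenomena-4576), line `subuniform-dead-pocket-maximum`,
# stub `stub_goodStep` — the kernel C1 and GOODNESS WITH TWO RELAYS (prover-siege k9)

Notation: `μ = prodBernoulli w`; `K = C(o)`; `D = {a₁ ↮ a₂}`; for a family `R` of vertex sets containing `o` and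
avoiding `a₁, a₂` ("pockets"), `F = {o ↔ a₂} ∪ {K ∈ R}`.
* `c1_event` — **the kernel C1** (lead c1, `Cruxes/AdditiveGluing/Lines/…-goodstep-c1.md` §3, conjectured there;
  now a theorem): `μ(a₁ ↔ b) ≤ μ(a₂ ↔ b) ⟹ μ(D ∩ F ∩ {a₁ ↔ b}) ≤ μ(D ∩ F ∩ {a₂ ↔ b})` for EVERY pocket family
  `R` (`R = ∅`: Kozma–Nitzan Lemma 3(i) at `Q = {o ↔ a₂}`; `R` = all dead pockets: Lemma 3(ii) at `Q = {a₁ ↮ o}`,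
  arXiv:2401.12397 pp. 6–7).  Proof: the conditional-covariance inequalities H1/H2 of the lead's analysis are the
  instances `(s, Z) = (a₁, {a₂})` (complementary family) and `(a₂, {a₁})` of `PocketBHK.pocket_cov_event`, and
  `P(a₁b | F) ≤ P(a₁b) ≤ P(a₂b) ≤ P(a₂b | F)` under `P = μ(· | D)`.
* `exchange_two_relays` — the EXCHANGE FORM of goodness (siege k46, `…GoodStepBridge.lean`) at the worse relay for
  `A ⊆ {a₁, a₂, b}`, from `c1_event` with `R = {dead W : sel W = a₂}` and the pocket Markov property.
* `good_of_card_erase_le_two` (registered sub-goal `stub_goodTwoRelays_k9`) — **every quadruple with at most two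
  relays besides the target is GOOD** (skeleton selection form): Kozma–Nitzan's Theorem 1 (p. 7) strengthened by
  the dead-pocket penalty of KN §3.2 — rung 2 of the induction on `|A ∖ b|` behind `stub_goodStep`.
No definitions. -/

namespace Summit.CriticalPhenomena.PercolationContinuityZ3.Theorems

namespace PocketBHK

open MeasureTheory Set
open Literature.Probability.LatticeModels (prodBernoulli)
open Literature.Probability.Percolation
open scoped BigOperators Classical

noncomputable section

variable {V : Type*} [Fintype V]

omit [Fintype V] in
/-- On `{a₁ ↔ a₂}` the events `{a₁ ↔ b}` and `{a₂ ↔ b}` coincide. [folklore] -/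
theorem openConn_diff_eq (a₁ a₂ b : V) :
    (openConn a₁ b : Set (BondConfig V)) \ {ω | ¬ (openGraph ω).Reachable a₁ a₂} =
      (openConn a₂ b : Set (BondConfig V)) \ {ω | ¬ (openGraph ω).Reachable a₁ a₂} := by
  ext ω
  simp only [Set.mem_sdiff, Set.mem_setOf_eq, not_not]
  constructor
  · rintro ⟨h, h12⟩; exact ⟨h12.symm.trans h, h12⟩
  · rintro ⟨h, h12⟩; exact ⟨h12.trans h, h12⟩

/-- `μ(E ∩ {a₁↔b}) − μ(E ∩ {a₂↔b})` is unchanged by intersecting with `D = {a₁ ↮ a₂}`. [folklore] -/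
theorem real_inter_openConn_sub_eq (w : Sym2 V → unitInterval) (E : Set (BondConfig V)) (a₁ a₂ b : V) :
    (prodBernoulli w).real (E ∩ openConn a₁ b) - (prodBernoulli w).real (E ∩ openConn a₂ b) =
      (prodBernoulli w).real (E ∩ openConn a₁ b ∩ {ω | ¬ (openGraph ω).Reachable a₁ a₂}) -
        (prodBernoulli w).real (E ∩ openConn a₂ b ∩ {ω | ¬ (openGraph ω).Reachable a₁ a₂}) := by
  have hDm : MeasurableSet {ω : BondConfig V | ¬ (openGraph ω).Reachable a₁ a₂} := MeasurableSet.of_discrete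
  have h1 := measureReal_inter_add_sdiff (μ := prodBernoulli w) (s := E ∩ openConn a₁ b) hDm
  have h2 := measureReal_inter_add_sdiff (μ := prodBernoulli w) (s := E ∩ openConn a₂ b) hDm
  have he : (E ∩ openConn a₁ b) \ {ω : BondConfig V | ¬ (openGraph ω).Reachable a₁ a₂} =
      (E ∩ openConn a₂ b) \ {ω | ¬ (openGraph ω).Reachable a₁ a₂} := by
    rw [Set.inter_sdiff_assoc, Set.inter_sdiff_assoc, openConn_diff_eq]
  rw [he] at h1
  linarith

/-- **The kernel C1** (lead c1's conjecture; new theorem): for `o, a₁, a₂, b`, `D = {a₁ ↮ a₂}`, ANY family `R`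
of vertex sets containing `o` and avoiding `a₁, a₂`, and `F = {o ↔ a₂} ∪ {C(o) ∈ R}`:
`μ(a₁ ↔ b) ≤ μ(a₂ ↔ b) ⟹ μ(D ∩ F ∩ {a₁ ↔ b}) ≤ μ(D ∩ F ∩ {a₂ ↔ b})` (interpolates Kozma–Nitzan Lemma 3(i)/(ii),
arXiv:2401.12397 pp. 6–7; two instances of `pocket_cov_event`). [folklore] -/
theorem c1_event (w : Sym2 V → unitInterval) (o a₁ a₂ b : V) (R : Set (Set V))
    (hR : ∀ W ∈ R, o ∈ W ∧ a₁ ∉ W ∧ a₂ ∉ W)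
    (hτ : (prodBernoulli w).real (openConn a₁ b) ≤ (prodBernoulli w).real (openConn a₂ b)) :
    (prodBernoulli w).real ({ω | ¬ (openGraph ω).Reachable a₁ a₂} ∩
        {ω | (openGraph ω).Reachable o a₂ ∨ openCluster ω o ∈ R} ∩ openConn a₁ b) ≤
    (prodBernoulli w).real ({ω | ¬ (openGraph ω).Reachable a₁ a₂} ∩
        {ω | (openGraph ω).Reachable o a₂ ∨ openCluster ω o ∈ R} ∩ openConn a₂ b) := by
  set μ := prodBernoulli w with hμ
  haveI : IsProbabilityMeasure μ := by rw [hμ]; infer_instance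
  set D : Set (BondConfig V) := {ω | ¬ (openGraph ω).Reachable a₁ a₂} with hD
  set F : Set (BondConfig V) := {ω | (openGraph ω).Reachable o a₂ ∨ openCluster ω o ∈ R} with hF
  set R' : Set (Set V) := {W | o ∈ W ∧ a₁ ∉ W ∧ a₂ ∉ W ∧ W ∉ R} with hR'
  set E₁ : Set (BondConfig V) := {ω | (openGraph ω).Reachable o a₁ ∨ openCluster ω o ∈ R'} with hE₁
  have hcomp : ∀ ω ∈ D, (ω ∈ E₁ ↔ ω ∉ F) := by
    intro ω hωD
    have hωD' : ¬ (openGraph ω).Reachable a₁ a₂ := hωD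
    constructor
    · rintro (h1 | h1) (h2 | h2)
      · exact hωD' (h1.symm.trans h2)
      · exact (hR _ h2).2.1 h1
      · exact h1.2.2.1 h2
      · exact h1.2.2.2 h2
    · intro hF'
      by_cases h1 : (openGraph ω).Reachable o a₁
      · exact Or.inl h1
      · refine Or.inr ⟨mem_openCluster_self ω o, h1, fun h2 => hF' (Or.inl h2), fun h2 => hF' (Or.inr h2)⟩
  have hDm : MeasurableSet D := MeasurableSet.of_discrete
  have hFm : MeasurableSet F := MeasurableSet.of_discrete
  have hsplit : ∀ S : Set (BondConfig V), μ.real (D ∩ E₁ ∩ S) = μ.real (D ∩ S) - μ.real (D ∩ F ∩ S) := by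
    intro S
    have h := measureReal_inter_add_sdiff (μ := μ) (s := D ∩ S) hFm
    have e1 : D ∩ S ∩ F = D ∩ F ∩ S := by ext ω; simp only [Set.mem_inter_iff]; tauto
    have e2 : (D ∩ S) \ F = D ∩ E₁ ∩ S := by
      ext ω
      simp only [Set.mem_sdiff, Set.mem_inter_iff]
      constructor
      · rintro ⟨⟨hD', hS⟩, hF'⟩; exact ⟨⟨hD', (hcomp ω hD').2 hF'⟩, hS⟩
      · rintro ⟨⟨hD', hE⟩, hS⟩; exact ⟨⟨hD', hS⟩, (hcomp ω hD').1 hE⟩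
    rw [e1, e2] at h
    linarith
  -- H1: `pocket_cov_event` at `(s, Z) = (a₁, {a₂})` with the complementary family
  have hR'h : ∀ W ∈ R', o ∈ W ∧ a₁ ∉ W ∧ ∀ z ∈ ({a₂} : Set V), z ∉ W := fun W hW =>
    ⟨hW.1, hW.2.1, fun z hz => by rw [Set.mem_singleton_iff.1 hz]; exact hW.2.2.1⟩
  have H1 := pocket_cov_event w a₁ o b ({a₂} : Set V) R' hR'h
  have hD1 : {ω : BondConfig V | ∀ z ∈ ({a₂} : Set V), ¬ (openGraph ω).Reachable a₁ z} = D := by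
    ext ω; simp [hD]
  rw [hD1] at H1
  -- H2: `pocket_cov_event` at `(s, Z) = (a₂, {a₁})` with the family `R`
  have hRh : ∀ W ∈ R, o ∈ W ∧ a₂ ∉ W ∧ ∀ z ∈ ({a₁} : Set V), z ∉ W := fun W hW =>
    ⟨(hR W hW).1, (hR W hW).2.2, fun z hz => by rw [Set.mem_singleton_iff.1 hz]; exact (hR W hW).2.1⟩
  have H2 := pocket_cov_event w a₂ o b ({a₁} : Set V) R hRh
  have hD2 : {ω : BondConfig V | ∀ z ∈ ({a₁} : Set V), ¬ (openGraph ω).Reachable a₂ z} = D := by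
    ext ω
    simp only [Set.mem_singleton_iff, forall_eq, hD, Set.mem_setOf_eq]
    exact ⟨fun h h' => h h'.symm, fun h h' => h h'.symm⟩
  rw [hD2] at H2
  have hs1 := hsplit Set.univ
  have hs2 := hsplit (openConn a₁ b)
  simp only [Set.inter_univ] at hs1
  rw [hs1, hs2] at H1
  have hτD : μ.real (D ∩ openConn a₁ b) ≤ μ.real (D ∩ openConn a₂ b) := by
    have h := real_inter_openConn_sub_eq w Set.univ a₁ a₂ b
    simp only [Set.univ_inter] at h
    rw [Set.inter_comm, Set.inter_comm D]
    linarith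
  have hle1 : μ.real (D ∩ F ∩ openConn a₁ b) ≤ μ.real D :=
    measureReal_mono (Set.inter_subset_left.trans Set.inter_subset_left)
  have hn0 : 0 ≤ μ.real (D ∩ F ∩ openConn a₂ b) := measureReal_nonneg
  have hnF : 0 ≤ μ.real (D ∩ F) := measureReal_nonneg
  have hn2 : 0 ≤ μ.real (D ∩ openConn a₂ b) := measureReal_nonneg
  by_cases hD0 : μ.real D = 0
  · linarith
  have hDpos : 0 < μ.real D := lt_of_le_of_ne measureReal_nonneg (Ne.symm hD0)
  -- chain: μD·μ(DFa₁b) ≤ μDF·μ(Da₁b) ≤ μDF·μ(Da₂b) ≤ μD·μ(DFa₂b)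
  have c1 : μ.real D * μ.real (D ∩ F ∩ openConn a₁ b) ≤ μ.real (D ∩ F) * μ.real (D ∩ openConn a₁ b) := by
    nlinarith [H1]
  have c2 : μ.real (D ∩ F) * μ.real (D ∩ openConn a₁ b) ≤ μ.real (D ∩ F) * μ.real (D ∩ openConn a₂ b) :=
    mul_le_mul_of_nonneg_left hτD hnF
  have c3 : μ.real (D ∩ F) * μ.real (D ∩ openConn a₂ b) ≤ μ.real D * μ.real (D ∩ F ∩ openConn a₂ b) := by
    have := H2; nlinarith [this]
  have c4 : μ.real D * μ.real (D ∩ F ∩ openConn a₁ b) ≤ μ.real D * μ.real (D ∩ F ∩ openConn a₂ b) :=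
    c1.trans (c2.trans c3)
  exact le_of_mul_le_mul_left c4 hDpos

end

end PocketBHK

/-! ### Goodness with two relays, in the skeleton's vocabulary (`Fin n`) -/

open MeasureTheory Set
open Literature.Probability.LatticeModels (prodBernoulli)
open Literature.Probability.Percolation
open scoped BigOperators Classical

noncomputable section

variable {n : ℕ}

/-- **Exchange form of goodness at the worse of two relays** (new; lead c1's `X + Pen ≤ Y`, every selection):
`b, a₁, a₂ ∈ A ⊆ {a₁, a₂, b}`, `o ∉ A`, `μ(a₁ ↔ b) ≤ μ(a₂ ↔ b)` ⟹ for every selection `sel W ∈ A`,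
`μ(a₁↔b, o↮b, o↔A) + Σ_{W dead} μ(C(o)=W)·(τ_W(a₁) − τ_W(sel W)) ≤ μ(o↔b, a₁↮b)`
(`c1_event` with `R = {dead W : sel W = a₂}` + the pocket Markov property). [folklore] -/
theorem exchange_two_relays (w : Sym2 (Fin n) → unitInterval) (A : Finset (Fin n)) (o b a₁ a₂ : Fin n)
    (hbA : b ∈ A) (ha₁A : a₁ ∈ A) (ha₂A : a₂ ∈ A) (hA : A ⊆ {a₁, a₂, b}) (hoA : o ∉ A)
    (hτ : (prodBernoulli w).real (openConn a₁ b) ≤ (prodBernoulli w).real (openConn a₂ b))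
    (sel : Finset (Fin n) → Fin n) (hsel : ∀ W, sel W ∈ A) :
    (prodBernoulli w).real (openConn a₁ b ∩ (openConn o b)ᶜ ∩ ⋃ a ∈ A, openConn o a)
      + ∑ W ∈ (Finset.univ : Finset (Finset (Fin n))).filter (fun W => o ∈ W ∧ Disjoint W A),
          (prodBernoulli w).real {ω : BondConfig (Fin n) | openCluster ω o = (W : Set (Fin n))}
            * ((prodBernoulli w).real (openConnIn ((W : Set (Fin n))ᶜ) a₁ b)
                - (prodBernoulli w).real (openConnIn ((W : Set (Fin n))ᶜ) (sel W) b))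
      ≤ (prodBernoulli w).real (openConn o b ∩ (openConn a₁ b)ᶜ) := by
  set μ := prodBernoulli w with hμ
  haveI : IsProbabilityMeasure μ := by rw [hμ]; infer_instance
  set D : Set (BondConfig (Fin n)) := {ω | ¬ (openGraph ω).Reachable a₁ a₂} with hD
  set dead := (Finset.univ : Finset (Finset (Fin n))).filter (fun W => o ∈ W ∧ Disjoint W A) with hdead
  set R : Set (Set (Fin n)) := {S | ∃ W ∈ dead, sel W = a₂ ∧ S = ↑W} with hR
  set F : Set (BondConfig (Fin n)) := {ω | (openGraph ω).Reachable o a₂ ∨ openCluster ω o ∈ R} with hF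
  have ha₁o : a₁ ≠ o := fun h => hoA (h ▸ ha₁A)
  have hmemdead : ∀ W, W ∈ dead ↔ o ∈ W ∧ Disjoint W A := fun W => by
    simp only [hdead, Finset.mem_filter, Finset.mem_univ, true_and]
  have hR' : ∀ S ∈ R, o ∈ S ∧ a₁ ∉ S ∧ a₂ ∉ S := by
    rintro S ⟨W, hW, -, rfl⟩
    obtain ⟨hoW, hWA⟩ := (hmemdead W).1 hW
    exact ⟨Finset.mem_coe.2 hoW, fun h => Finset.disjoint_left.1 hWA (Finset.mem_coe.1 h) ha₁A,
      fun h => Finset.disjoint_left.1 hWA (Finset.mem_coe.1 h) ha₂A⟩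
  have hC1 := PocketBHK.c1_event w o a₁ a₂ b R hR' hτ
  -- the pocket event decomposed: `D ∩ F ∩ E = (D ∩ {o↔a₂} ∩ E) ⊔ ⋃_{W dead, sel W = a₂} ({C(o)=W} ∩ D ∩ E)`
  have hdecomp : ∀ E : Set (BondConfig (Fin n)), μ.real (D ∩ F ∩ E) =
      μ.real (D ∩ (openConn o a₂ : Set (BondConfig (Fin n))) ∩ E) +
        ∑ W ∈ dead.filter (fun W => sel W = a₂), μ.real (clusterIs o W ∩ (E ∩ D)) := by
    intro E
    have hset : D ∩ F ∩ E = (D ∩ (openConn o a₂ : Set (BondConfig (Fin n))) ∩ E) ∪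
        ⋃ W ∈ dead.filter (fun W => sel W = a₂), (clusterIs o W ∩ (E ∩ D)) := by
      ext ω
      simp only [Set.mem_inter_iff, Set.mem_union, Set.mem_iUnion, Finset.mem_filter, exists_prop,
        mem_clusterIs, hF, Set.mem_setOf_eq, hR]
      constructor
      · rintro ⟨⟨hD', hr | ⟨W, hW, hs, hS⟩⟩, hE⟩
        · exact Or.inl ⟨⟨hD', hr⟩, hE⟩
        · exact Or.inr ⟨W, ⟨hW, hs⟩, hS, hE, hD'⟩
      · rintro (⟨⟨hD', hr⟩, hE⟩ | ⟨W, ⟨hW, hs⟩, hS, hE, hD'⟩)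
        · exact ⟨⟨hD', Or.inl hr⟩, hE⟩
        · exact ⟨⟨hD', Or.inr ⟨W, hW, hs, hS⟩⟩, hE⟩
    have hdisj1 : Disjoint (D ∩ (openConn o a₂ : Set (BondConfig (Fin n))) ∩ E)
        (⋃ W ∈ dead.filter (fun W => sel W = a₂), (clusterIs o W ∩ (E ∩ D))) := by
      rw [Set.disjoint_left]
      rintro ω ⟨⟨-, hr⟩, -⟩ hU
      simp only [Set.mem_iUnion, Finset.mem_filter, exists_prop, Set.mem_inter_iff, mem_clusterIs] at hU
      obtain ⟨W, ⟨hW, -⟩, hS, -⟩ := hU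
      have ha₂W : a₂ ∈ openCluster ω o := hr
      rw [hS] at ha₂W
      exact Finset.disjoint_left.1 ((hmemdead W).1 hW).2 (Finset.mem_coe.1 ha₂W) ha₂A
    have hpd : Set.PairwiseDisjoint (↑(dead.filter fun W => sel W = a₂))
        (fun W : Finset (Fin n) => clusterIs o W ∩ (E ∩ D)) := by
      intro W _ W' _ hne
      refine Set.disjoint_left.2 fun ω h h' => hne ?_
      have h1 : openCluster ω o = ↑W := (mem_clusterIs.1 h.1)
      have h2 : openCluster ω o = ↑W' := (mem_clusterIs.1 h'.1)
      exact Finset.coe_inj.1 (h1.symm.trans h2)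
    rw [hset, measureReal_union (μ := μ) hdisj1 MeasurableSet.of_discrete (measure_ne_top μ _)
        (measure_ne_top μ _),
      measureReal_biUnion_finset (μ := μ) hpd (fun _ _ => MeasurableSet.of_discrete)
        fun _ _ => measure_ne_top μ _]
  -- `X(a₁) = μ(D ∩ {o↔a₂} ∩ {a₁↔b})`
  have hX : (openConn a₁ b ∩ (openConn o b)ᶜ ∩ ⋃ a ∈ A, openConn o a : Set (BondConfig (Fin n))) =
      D ∩ (openConn o a₂ : Set (BondConfig (Fin n))) ∩ openConn a₁ b := by
    ext ω
    simp only [Set.mem_inter_iff, Set.mem_compl_iff, Set.mem_iUnion, exists_prop, hD, Set.mem_setOf_eq]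
    constructor
    · rintro ⟨⟨hab, hob⟩, a, haA, hoa⟩
      have ha : a = a₁ ∨ a = a₂ ∨ a = b := by simpa [Finset.mem_insert, Finset.mem_singleton] using hA haA
      have hoa' : (openGraph ω).Reachable o a := hoa
      have hab' : (openGraph ω).Reachable a₁ b := hab
      rcases ha with rfl | rfl | rfl
      · exact absurd (hoa'.trans hab') hob
      · exact ⟨⟨fun h12 => hob (hoa'.trans (h12.symm.trans hab')), hoa⟩, hab⟩
      · exact absurd hoa' hob
    · rintro ⟨⟨h12, hoa⟩, hab⟩
      have hoa' : (openGraph ω).Reachable o a₂ := hoa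
      have hab' : (openGraph ω).Reachable a₁ b := hab
      refine ⟨⟨hab, fun hob => h12 (hab'.trans ((hob : (openGraph ω).Reachable o b).symm.trans hoa'))⟩,
        a₂, ha₂A, hoa⟩
  -- `μ(D ∩ {o↔a₂} ∩ {a₂↔b}) ≤ Y(a₁)`
  have hY : D ∩ (openConn o a₂ : Set (BondConfig (Fin n))) ∩ openConn a₂ b ⊆
      openConn o b ∩ (openConn a₁ b)ᶜ := by
    rintro ω ⟨⟨h12, hoa⟩, hab⟩
    have hoa' : (openGraph ω).Reachable o a₂ := hoa
    have hab' : (openGraph ω).Reachable a₂ b := hab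
    exact ⟨hoa'.trans hab', fun h1b => h12 ((h1b : (openGraph ω).Reachable a₁ b).trans (hab'.symm))⟩
  have hpen : ∀ W ∈ dead, μ.real {ω : BondConfig (Fin n) | openCluster ω o = (W : Set (Fin n))}
      * (μ.real (openConnIn ((W : Set (Fin n))ᶜ) a₁ b) - μ.real (openConnIn ((W : Set (Fin n))ᶜ) (sel W) b)) ≤
      if sel W = a₂ then μ.real (clusterIs o W ∩ (openConn a₁ b ∩ D)) - μ.real (clusterIs o W ∩ (openConn a₂ b ∩ D))
      else 0 := by
    intro W hW
    obtain ⟨hoW, hWA⟩ := (hmemdead W).1 hW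
    have ha₁W : a₁ ∉ W := fun h => Finset.disjoint_left.1 hWA h ha₁A
    have ha₂W : a₂ ∉ W := fun h => Finset.disjoint_left.1 hWA h ha₂A
    rw [goodBridge_setOf_eq_clusterIs, mul_sub, ← goodBridge_real_clusterIs_inter_openConn w W o a₁ b ha₁W]
    split_ifs with hs
    · rw [hs, ← goodBridge_real_clusterIs_inter_openConn w W o a₂ b ha₂W,
        PocketBHK.real_inter_openConn_sub_eq w (clusterIs o W) a₁ a₂ b, Set.inter_assoc, Set.inter_assoc]
    · have hs' : sel W = a₁ ∨ sel W = b := by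
        have := hA (hsel W)
        simp only [Finset.mem_insert, Finset.mem_singleton] at this
        tauto
      rcases hs' with h | h
      · rw [h, goodBridge_real_clusterIs_inter_openConn w W o a₁ b ha₁W, sub_self]
      · rw [h]
        have hbW : b ∈ ((W : Set (Fin n))ᶜ) := fun hbW' =>
          Finset.disjoint_left.1 hWA (Finset.mem_coe.1 hbW') hbA
        have huniv : (openConnIn ((W : Set (Fin n))ᶜ) b b : Set (BondConfig (Fin n))) = Set.univ :=
          Set.eq_univ_of_forall fun ω => ⟨hbW, hbW, SimpleGraph.Reachable.refl _⟩
        rw [huniv, probReal_univ, goodBridge_real_clusterIs_inter_openConn w W o a₁ b ha₁W, mul_one]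
        exact sub_nonpos.2 (mul_le_of_le_one_right measureReal_nonneg measureReal_le_one)
  have hsum : ∑ W ∈ dead, μ.real {ω : BondConfig (Fin n) | openCluster ω o = (W : Set (Fin n))}
      * (μ.real (openConnIn ((W : Set (Fin n))ᶜ) a₁ b) - μ.real (openConnIn ((W : Set (Fin n))ᶜ) (sel W) b)) ≤
      ∑ W ∈ dead.filter (fun W => sel W = a₂), μ.real (clusterIs o W ∩ (openConn a₁ b ∩ D)) -
        ∑ W ∈ dead.filter (fun W => sel W = a₂), μ.real (clusterIs o W ∩ (openConn a₂ b ∩ D)) := by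
    refine (Finset.sum_le_sum hpen).trans (le_of_eq ?_)
    rw [Finset.sum_ite, Finset.sum_const_zero, add_zero, Finset.sum_sub_distrib]
  have h1 := hdecomp (openConn a₁ b)
  have h2 := hdecomp (openConn a₂ b)
  rw [hX]
  have hYm := measureReal_mono (μ := μ) hY
  linarith [hC1, h1, h2, hsum, hYm]

/-- **Goodness with at most two relays** (new: Kozma–Nitzan's Theorem 1, arXiv:2401.12397 p. 7, WITH the
dead-pocket penalty of KN §3.2; the `|A ∖ b| = 2` kernel of `stub_goodStep`): if `b ∈ A`, `o ∉ A`,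
`|A ∖ b| ≤ 2`, then for every level `t` with `1 − t ≤ μ(a ↔ b)` on `A` and every selection `sel W ∈ A`,
`μ(o ↔ A, o ↮ b) + Σ_{W ∋ o, W ∩ A = ∅} μ(C(o) = W) · μ((sel W ↔ b in Wᶜ)ᶜ) ≤ t` (rungs 0–1 as in siege k46;
rung 2: `exchange_two_relays` at the worse relay + `good_of_exchange`). [folklore] -/
theorem good_of_card_erase_le_two :
    ∀ (n : ℕ) (w : Sym2 (Fin n) → unitInterval) (A : Finset (Fin n)) (o b : Fin n),
      b ∈ A → o ∉ A → (A.erase b).card ≤ 2 →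
      ∀ (t : ℝ) (sel : Finset (Fin n) → Fin n), (∀ W, sel W ∈ A) →
        (∀ a ∈ A, 1 - t ≤ (prodBernoulli w).real (openConn a b)) →
        (prodBernoulli w).real ((⋃ a ∈ A, openConn o a) ∩ (openConn o b)ᶜ)
          + ∑ W ∈ (Finset.univ : Finset (Finset (Fin n))).filter (fun W => o ∈ W ∧ Disjoint W A),
              (prodBernoulli w).real {ω : BondConfig (Fin n) | openCluster ω o = (W : Set (Fin n))}
                * (prodBernoulli w).real (openConnIn ((W : Set (Fin n))ᶜ) (sel W) b)ᶜ
          ≤ t := by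
  intro n w A o b hbA hoA hcard t sel hsel hlev
  by_cases h1 : (A.erase b).card ≤ 1
  · -- rungs 0–1 (as in siege k46's `good_of_card_erase_le_one`): `A ⊆ {a₀, b}`
    obtain ⟨a₀, ha₀A, hsub⟩ : ∃ a₀ ∈ A, A ⊆ {a₀, b} := by
      rcases Nat.le_one_iff_eq_zero_or_eq_one.1 h1 with h0 | h0
      · refine ⟨b, hbA, fun z hz => ?_⟩
        have : z ∈ A.erase b ∨ z = b := by
          by_cases hzb : z = b
          · exact Or.inr hzb
          · exact Or.inl (Finset.mem_erase.2 ⟨hzb, hz⟩)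
        rcases this with h | h
        · rw [Finset.card_eq_zero.1 h0] at h; exact absurd h (Finset.notMem_empty z)
        · simp [h]
      · obtain ⟨a₀, ha₀⟩ := Finset.card_eq_one.1 h0
        refine ⟨a₀, Finset.mem_of_mem_erase (ha₀.symm ▸ Finset.mem_singleton_self a₀), fun z hz => ?_⟩
        by_cases hzb : z = b
        · simp [hzb]
        · have : z ∈ A.erase b := Finset.mem_erase.2 ⟨hzb, hz⟩
          rw [ha₀] at this
          simp [Finset.mem_singleton.1 this]
    refine good_of_exchange w A o b a₀ hbA ha₀A t sel (hlev a₀ ha₀A) ?_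
    -- the exchange form is trivial here: `X(a₀) = 0` and every penalty summand is `≤ 0`
    have hX : (openConn a₀ b ∩ (openConn o b)ᶜ ∩ ⋃ a ∈ A, openConn o a : Set (BondConfig (Fin n))) = ∅ := by
      ext ω
      simp only [Set.mem_inter_iff, Set.mem_compl_iff, Set.mem_iUnion, Set.mem_empty_iff_false,
        iff_false, not_and, not_exists]
      rintro ⟨hab, hob⟩ a haA hoa
      have ha : a = a₀ ∨ a = b := by simpa [Finset.mem_insert, Finset.mem_singleton] using hsub haA
      rcases ha with rfl | rfl
      · exact hob ((show (openGraph ω).Reachable o a from hoa).trans hab)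
      · exact hob hoa
    rw [hX, measureReal_empty, zero_add]
    refine (Finset.sum_nonpos fun W hW => ?_).trans measureReal_nonneg
    rw [Finset.mem_filter] at hW
    refine mul_nonpos_of_nonneg_of_nonpos measureReal_nonneg (sub_nonpos.2 ?_)
    have hs : sel W = a₀ ∨ sel W = b := by
      simpa [Finset.mem_insert, Finset.mem_singleton] using hsub (hsel W)
    rcases hs with h | h
    · rw [h]
    · rw [h]
      have hbW : b ∈ ((W : Set (Fin n))ᶜ) := fun hbW' =>
        Finset.disjoint_left.1 hW.2.2 (Finset.mem_coe.1 hbW') hbA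
      have huniv : (openConnIn ((W : Set (Fin n))ᶜ) b b : Set (BondConfig (Fin n))) = Set.univ :=
        Set.eq_univ_of_forall fun ω => ⟨hbW, hbW, SimpleGraph.Reachable.refl _⟩
      rw [huniv, probReal_univ]
      exact measureReal_le_one
  have h2 : (A.erase b).card = 2 := by omega
  obtain ⟨x, y, hxy, hxy'⟩ := Finset.card_eq_two.1 h2
  have hxA : x ∈ A := Finset.mem_of_mem_erase (hxy'.symm ▸ Finset.mem_insert_self x {y})
  have hyA : y ∈ A := Finset.mem_of_mem_erase (hxy'.symm ▸ Finset.mem_insert_of_mem (Finset.mem_singleton_self y))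
  have hAsub : ∀ {a₁ a₂ : Fin n}, A.erase b = {a₁, a₂} → A ⊆ {a₁, a₂, b} := by
    intro a₁ a₂ he z hz
    by_cases hzb : z = b
    · simp [hzb]
    · have : z ∈ A.erase b := Finset.mem_erase.2 ⟨hzb, hz⟩
      rw [he] at this
      simp only [Finset.mem_insert, Finset.mem_singleton] at this ⊢
      tauto
  -- the worse of the two relays
  rcases le_total ((prodBernoulli w).real (openConn x b)) ((prodBernoulli w).real (openConn y b)) with hτ | hτ
  · exact good_of_exchange w A o b x hbA hxA t sel (hlev x hxA)
      (exchange_two_relays w A o b x y hbA hxA hyA (hAsub hxy') hoA hτ sel hsel)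
  · have hyx : A.erase b = {y, x} := by rw [hxy', Finset.pair_comm]
    exact good_of_exchange w A o b y hbA hyA t sel (hlev y hyA)
      (exchange_two_relays w A o b y x hbA hyA hxA (hAsub hyx) hoA hτ sel hsel)

/-- **Registered sub-goal `stub_goodTwoRelays_k9` of `stub_goodStep`** (siege k9; = `good_of_card_erase_le_two`):
the conclusion of `stub_goodStep` for every `(w, A, o, b)` with `b ∈ A`, `o ∉ A`, `(A.erase b).card ≤ 2` —
neither the low-neighbour hypothesis nor the induction hypothesis is needed. [folklore] -/
theorem stub_goodTwoRelays_k9 :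
    ∀ (n : ℕ) (w : Sym2 (Fin n) → unitInterval) (A : Finset (Fin n)) (o b : Fin n),
      b ∈ A → o ∉ A → (A.erase b).card ≤ 2 →
      ∀ (t : ℝ) (sel : Finset (Fin n) → Fin n), (∀ W, sel W ∈ A) →
        (∀ a ∈ A, 1 - t ≤ (Literature.Probability.LatticeModels.prodBernoulli w).real
          (Literature.Probability.Percolation.openConn a b)) →
        (Literature.Probability.LatticeModels.prodBernoulli w).real
            ((⋃ a ∈ A, Literature.Probability.Percolation.openConn o a) ∩
              (Literature.Probability.Percolation.openConn o b)ᶜ)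
          + ∑ W ∈ (Finset.univ : Finset (Finset (Fin n))).filter (fun W => o ∈ W ∧ Disjoint W A),
              (Literature.Probability.LatticeModels.prodBernoulli w).real
                  {ω : Literature.Probability.Percolation.BondConfig (Fin n) |
                    Literature.Probability.Percolation.openCluster ω o = (W : Set (Fin n))}
                * (Literature.Probability.LatticeModels.prodBernoulli w).real
                  (Literature.Probability.Percolation.openConnIn ((W : Set (Fin n))ᶜ) (sel W) b)ᶜ
          ≤ t :=
  good_of_card_erase_le_two

end

end Summit.CriticalPhenomena.PercolationContinuityZ3.Theorems
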